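import Literature.MeasureTheory.Group.SubgroupRelIndexMeasure      -- ★ `measure_subgroup_eq_relIndex_mul_of_isCompact` (`μ K = [K : K₁] · μ K₁` for compact-open levels)
import Mathlib.GroupTheory.QuotientGroup.Basic
import Mathlib.GroupTheory.Index
import Mathlib.Algebra.Group.Subgroup.Pointwise
import Mathlib.Topology.Algebra.OpenSubgroup
import HarnessLib

/-!
# F0 · P3c · line LH6 «StCharTS» — ROAD «JAC-LOC» brick (J4a) «ABELIAN SANDWICH»: subgroups between `E` and `K` when `K ∕ E` is abelian — the product
# `B̄·C·B·E` is a subgroup, its index over `E` is the product of the three indices under independence, and its Haar volume is that product times `vol E`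

Cell `pub/hodgecm-mathlib`, crux H413 = `stmt-HodgeConjecture-24833` (lane `--supports … --as helper`), route HCCMUnconditional; seat F0P2-p06 (g17), brick (J4a) of
the JAC-LOC road of LH6-p03 (g5) (deal: bus F0∕P3b 2026-09-02T14:22:45Z «PLAN v2 for (J4)(J5): the ABELIAN SANDWICH»).  THEOREMS ONLY (no definition ∕ instance ∕
notation ∕ named fact ∕ `sorry`); Mathlib + ★ `Literature.MeasureTheory.Group.SubgroupRelIndexMeasure`.

WHAT (pure group theory, then one Haar corollary).  `G` a group, subgroups `E ≤ K` with `K ∕ E` ABELIAN in the binder form `hab : ∀ x ∈ K, ∀ y ∈ K, x y x⁻¹ y⁻¹ ∈ E`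
(so `E`, and every subgroup between `E` and `K`, is normalised by `K` — `le_normalizer_of_le_of_le`), and subgroups `B̄, C, B ≤ K` (on the road: the boxes
`N̄[γᾱ, γβ̄]`, `T_γ`, `N[γα, γβ]` inside `K = K_γ′`, `E = K_ε`).  Then:
(a) the subgroup `P := B̄ ⊔ (C ⊔ (B ⊔ E))` (a genuine `Subgroup G`, no definition introduced) has carrier the pointwise product `B̄ · (C · (B · E))`
(`coe_sandwich_eq`, Mathlib `Subgroup.coe_mul_of_left_le_normalizer_right` three times), i.e. `g ∈ P ↔ g = b̄ c b e` (`mem_sandwich_iff`), with `E ≤ P ≤ K`;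
(b) under INDEPENDENCE `hind : b̄ c b ∈ E → b̄ ∈ E ∧ c ∈ E ∧ b ∈ E` the relative index multiplies: `[P : E] = [B̄ : B̄ ∩ E]·[C : C ∩ E]·[B : B ∩ E]`, typed as
`E.relIndex P = E.relIndex B̄ * E.relIndex C * E.relIndex B` (`relIndex_sandwich_eq`; tower law + Noether's second isomorphism theorem in `relIndex` form
`relIndex_sup_right_of_le_normalizer` + the intersections `(B ⊔ E) ⊓ C = E ⊓ C`, `(C ⊔ (B ⊔ E)) ⊓ B̄ = E ⊓ B̄` forced by `hind`); unconditional in `ℕ` (index `0` = infinite);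
(c) for `G` a topological group with a left-invariant Borel measure `μ`, `K` compact and `E` open: `μ P = [B̄ : B̄ ∩ E]·[C : C ∩ E]·[B : B ∩ E] · μ E` with every factor
finite (`measure_sandwich_eq`, ★ `measure_subgroup_eq_relIndex_mul_of_isCompact`).  On the road this is `ν(P̃) = D(s)·ν(K_γ)` once (L7) evaluates the three box ratios.
HONEST LABEL: HC_CM is proved only modulo the 7 printed citations (2 remaining named inputs: hLiu418 = `stmt-HodgeConjecture-24832`, h413 = `stmt-HodgeConjecture-24833`)
until rung 0 closes; this file closes no organ (count-neutral bank for the hyperbolic half of the WIF antecedent).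

## References
* [DummitFoote2004] D. S. Dummit, R. M. Foote, *Abstract Algebra*, 3rd ed. (2004), §3.3 (second ∕ third isomorphism theorems, Thm. 18, Thm. 19; tower of indices).
* [HarishChandra1970] Harish-Chandra (notes by G. van Dijk), *Harmonic Analysis on Reductive p-adic Groups*, LNM 162 (1970), Lemma 22 (the tube count this serves).
* [Rogawski1990] J. D. Rogawski, *Automorphic Representations of Unitary Groups in Three Variables*, Ann. of Math. Stud. 123 (1990), §12.5 p. 182.
-/

set_option autoImplicit false
set_option linter.dupNamespace false

open scoped Pointwise ENNReal
open MeasureTheory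

namespace Summit.HodgeConjecture.HodgeConjecture.Cruxes.H413.F0P3cStCharTSAbelianSandwich

section Algebra

variable {G : Type*} [Group G] {K E : Subgroup G}

/-! ## §1 Subgroups between `E` and `K` are normalised by `K` when `K ∕ E` is abelian -/

/-- **Every subgroup `N` with `E ≤ N ≤ K` is normalised by `K`** when all commutators of `K` lie in `E`: `k n k⁻¹ = [k, n]·n ∈ E·N = N`. [cite: DummitFoote2004, §3.3] -/
theorem le_normalizer_of_le_of_le (hab : ∀ x ∈ K, ∀ y ∈ K, x * y * x⁻¹ * y⁻¹ ∈ E) {N : Subgroup G} (hEN : E ≤ N) (hNK : N ≤ K) :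
    K ≤ Subgroup.normalizer (N : Set G) := by
  intro k hk
  rw [Subgroup.mem_normalizer_iff]
  intro h
  constructor
  · intro hh
    have hc : k * h * k⁻¹ * h⁻¹ ∈ E := hab k hk h (hNK hh)
    have heq : k * h * k⁻¹ = (k * h * k⁻¹ * h⁻¹) * h := by group
    rw [heq]
    exact N.mul_mem (hEN hc) hh
  · intro hh'
    have hc : k⁻¹ * (k * h * k⁻¹) * k⁻¹⁻¹ * (k * h * k⁻¹)⁻¹ ∈ E := hab k⁻¹ (K.inv_mem hk) (k * h * k⁻¹) (hNK hh')
    have heq : h = (k⁻¹ * (k * h * k⁻¹) * k⁻¹⁻¹ * (k * h * k⁻¹)⁻¹) * (k * h * k⁻¹) := by group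
    rw [heq]
    exact N.mul_mem (hEN hc) hh'

/-- In particular `K` normalises `E` itself (the binder `hE : ∀ k ∈ K, ∀ e ∈ E, k e k⁻¹ ∈ E` of the road memo is DERIVED). [cite: DummitFoote2004, §3.3] -/
theorem conj_mem_of_mem (hEK : E ≤ K) (hab : ∀ x ∈ K, ∀ y ∈ K, x * y * x⁻¹ * y⁻¹ ∈ E) {k : G} (hk : k ∈ K) {e : G} (he : e ∈ E) :
    k * e * k⁻¹ ∈ E :=
  ((Subgroup.mem_normalizer_iff.1 (le_normalizer_of_le_of_le hab le_rfl hEK hk)) e).1 he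

/-! ## §2 (a) The sandwich `P = B̄ ⊔ (C ⊔ (B ⊔ E))` has carrier `B̄ · C · B · E` -/

variable {Bbar C B : Subgroup G}

/-- `E ≤ P` and `P ≤ K` for `P = B̄ ⊔ (C ⊔ (B ⊔ E))`. [cite: DummitFoote2004, §3.3] -/
theorem le_sandwich_and_sandwich_le (hEK : E ≤ K) (hBbar : Bbar ≤ K) (hC : C ≤ K) (hB : B ≤ K) :
    E ≤ Bbar ⊔ (C ⊔ (B ⊔ E)) ∧ Bbar ⊔ (C ⊔ (B ⊔ E)) ≤ K :=
  ⟨le_sup_right.trans (le_sup_right.trans le_sup_right), sup_le hBbar (sup_le hC (sup_le hB hEK))⟩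

/-- **(a) THE CARRIER OF THE SANDWICH**: `↑(B̄ ⊔ (C ⊔ (B ⊔ E))) = B̄ · (C · (B · E))` (pointwise products of carriers) — each factor normalises the subgroup to its
right (§1), so Mathlib's `Subgroup.coe_mul_of_left_le_normalizer_right` applies three times. [cite: DummitFoote2004, §3.3] -/
theorem coe_sandwich_eq (hEK : E ≤ K) (hab : ∀ x ∈ K, ∀ y ∈ K, x * y * x⁻¹ * y⁻¹ ∈ E) (hBbar : Bbar ≤ K) (hC : C ≤ K) (hB : B ≤ K) :
    ((Bbar ⊔ (C ⊔ (B ⊔ E)) : Subgroup G) : Set G) = (Bbar : Set G) * ((C : Set G) * ((B : Set G) * (E : Set G))) := by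
  have h3 : ((B ⊔ E : Subgroup G) : Set G) = (B : Set G) * (E : Set G) :=
    Subgroup.coe_mul_of_left_le_normalizer_right B E (hB.trans (le_normalizer_of_le_of_le hab le_rfl hEK))
  have h2 : ((C ⊔ (B ⊔ E) : Subgroup G) : Set G) = (C : Set G) * ((B ⊔ E : Subgroup G) : Set G) :=
    Subgroup.coe_mul_of_left_le_normalizer_right C (B ⊔ E) (hC.trans (le_normalizer_of_le_of_le hab le_sup_right (sup_le hB hEK)))
  have h1 : ((Bbar ⊔ (C ⊔ (B ⊔ E)) : Subgroup G) : Set G) = (Bbar : Set G) * ((C ⊔ (B ⊔ E) : Subgroup G) : Set G) :=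
    Subgroup.coe_mul_of_left_le_normalizer_right Bbar (C ⊔ (B ⊔ E))
      (hBbar.trans (le_normalizer_of_le_of_le hab (le_sup_right.trans le_sup_right) (sup_le hC (sup_le hB hEK))))
  rw [h1, h2, h3]

/-- **(a′) MEMBERSHIP IN THE SANDWICH**: `g ∈ B̄ ⊔ (C ⊔ (B ⊔ E)) ↔ g = b̄ c b e` with `b̄ ∈ B̄`, `c ∈ C`, `b ∈ B`, `e ∈ E` — the road's set
`P := {g | ∃ b̄ c b e, g = b̄ c b e}` IS this subgroup. [cite: DummitFoote2004, §3.3] -/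
theorem mem_sandwich_iff (hEK : E ≤ K) (hab : ∀ x ∈ K, ∀ y ∈ K, x * y * x⁻¹ * y⁻¹ ∈ E) (hBbar : Bbar ≤ K) (hC : C ≤ K) (hB : B ≤ K) (g : G) :
    g ∈ Bbar ⊔ (C ⊔ (B ⊔ E)) ↔ ∃ bbar ∈ Bbar, ∃ c ∈ C, ∃ b ∈ B, ∃ e ∈ E, g = bbar * c * b * e := by
  rw [← SetLike.mem_coe, coe_sandwich_eq hEK hab hBbar hC hB]
  constructor
  · rintro ⟨bbar, hbbar, _, ⟨c, hc, _, ⟨b, hb, e, he, rfl⟩, rfl⟩, rfl⟩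
    exact ⟨bbar, hbbar, c, hc, b, hb, e, he, by simp only [mul_assoc]⟩
  · rintro ⟨bbar, hbbar, c, hc, b, hb, e, he, rfl⟩
    exact ⟨bbar, hbbar, c * (b * e), ⟨c, hc, b * e, ⟨b, hb, e, he, rfl⟩, rfl⟩, by simp only [mul_assoc]⟩

/-! ## §3 (b) The relative index of the sandwich over `E` is the product of the three indices -/

/-- **Noether's second isomorphism theorem in `relIndex` form**: `[H ⊔ N : N] = [H : H ∩ N]` whenever `H` normalises `N` (Mathlib
`QuotientGroup.quotientInfEquivProdNormalizerQuotient`; the `[N.Normal]` version is Mathlib's `Subgroup.relIndex_sup_right`). [cite: DummitFoote2004, §3.3 Thm. 18] -/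
theorem relIndex_sup_right_of_le_normalizer (H N : Subgroup G) (hLE : H ≤ Subgroup.normalizer (N : Set G)) :
    N.relIndex (H ⊔ N) = N.relIndex H := by
  letI := Subgroup.normal_subgroupOf_of_le_normalizer hLE
  letI := Subgroup.normal_subgroupOf_sup_of_le_normalizer hLE
  exact Nat.card_congr (QuotientGroup.quotientInfEquivProdNormalizerQuotient H N hLE).toEquiv.symm

/-- Independence ⇒ `(B ⊔ E) ⊓ C = E ⊓ C`: if `c = b e` then `1 · c⁻¹ · b = e⁻¹ ∈ E`, so `c ∈ E`. [cite: DummitFoote2004, §3.3] -/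
theorem sup_inf_eq_inf_of_independent (hEK : E ≤ K) (hab : ∀ x ∈ K, ∀ y ∈ K, x * y * x⁻¹ * y⁻¹ ∈ E) (hB : B ≤ K)
    (hind : ∀ bbar ∈ Bbar, ∀ c ∈ C, ∀ b ∈ B, bbar * c * b ∈ E → bbar ∈ E ∧ c ∈ E ∧ b ∈ E) :
    (B ⊔ E) ⊓ C = E ⊓ C := by
  refine le_antisymm ?_ (inf_le_inf_right C le_sup_right)
  intro x hx
  have hx1 : x ∈ ((B ⊔ E : Subgroup G) : Set G) := (Subgroup.mem_inf.1 hx).1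
  have hxC : x ∈ C := (Subgroup.mem_inf.1 hx).2
  rw [Subgroup.coe_mul_of_left_le_normalizer_right B E (hB.trans (le_normalizer_of_le_of_le hab le_rfl hEK))] at hx1
  obtain ⟨b, hb, e, he, hbe⟩ := hx1
  have hprod : (1 : G) * x⁻¹ * b ∈ E := by
    rw [← hbe, one_mul, mul_inv_rev, mul_assoc, inv_mul_cancel, mul_one]
    exact E.inv_mem he
  have hxE : x⁻¹ ∈ E := (hind 1 Bbar.one_mem x⁻¹ (C.inv_mem hxC) b hb hprod).2.1
  exact Subgroup.mem_inf.2 ⟨(E.inv_mem_iff).1 hxE, hxC⟩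

/-- Independence ⇒ `(C ⊔ (B ⊔ E)) ⊓ B̄ = E ⊓ B̄`: if `b̄ = c b e` then `b̄⁻¹ · c · b = e⁻¹ ∈ E`, so `b̄ ∈ E`. [cite: DummitFoote2004, §3.3] -/
theorem sup_sup_inf_eq_inf_of_independent (hEK : E ≤ K) (hab : ∀ x ∈ K, ∀ y ∈ K, x * y * x⁻¹ * y⁻¹ ∈ E) (hC : C ≤ K) (hB : B ≤ K)
    (hind : ∀ bbar ∈ Bbar, ∀ c ∈ C, ∀ b ∈ B, bbar * c * b ∈ E → bbar ∈ E ∧ c ∈ E ∧ b ∈ E) :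
    (C ⊔ (B ⊔ E)) ⊓ Bbar = E ⊓ Bbar := by
  refine le_antisymm ?_ (inf_le_inf_right Bbar (le_sup_right.trans le_sup_right))
  intro x hx
  have hx1 : x ∈ ((C ⊔ (B ⊔ E) : Subgroup G) : Set G) := (Subgroup.mem_inf.1 hx).1
  have hxB : x ∈ Bbar := (Subgroup.mem_inf.1 hx).2
  rw [Subgroup.coe_mul_of_left_le_normalizer_right C (B ⊔ E) (hC.trans (le_normalizer_of_le_of_le hab le_sup_right (sup_le hB hEK))),
    Subgroup.coe_mul_of_left_le_normalizer_right B E (hB.trans (le_normalizer_of_le_of_le hab le_rfl hEK))] at hx1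
  obtain ⟨c, hc, _, ⟨b, hb, e, he, rfl⟩, hcbe⟩ := hx1
  have hprod : x⁻¹ * c * b ∈ E := by
    rw [← hcbe]
    have heq : (c * (b * e))⁻¹ * c * b = e⁻¹ := by group
    rw [heq]
    exact E.inv_mem he
  have hxE : x⁻¹ ∈ E := (hind x⁻¹ (Bbar.inv_mem hxB) c hc b hb hprod).1
  exact Subgroup.mem_inf.2 ⟨(E.inv_mem_iff).1 hxE, hxB⟩

/-- **(b) THE INDEX OF THE SANDWICH**: under independence, `[B̄ ⊔ (C ⊔ (B ⊔ E)) : E] = [B̄ : B̄ ∩ E]·[C : C ∩ E]·[B : B ∩ E]`, typed as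
`E.relIndex (B̄ ⊔ (C ⊔ (B ⊔ E))) = E.relIndex B̄ * E.relIndex C * E.relIndex B` (in `ℕ`, index `0` = infinite; tower law along `E ≤ B ⊔ E ≤ C ⊔ (B ⊔ E) ≤ P`, each step a
second-isomorphism index by §1, the intersections collapsed to `E ∩ ·` by independence). [cite: DummitFoote2004, §3.3 Thm. 18, Thm. 19] -/
theorem relIndex_sandwich_eq (hEK : E ≤ K) (hab : ∀ x ∈ K, ∀ y ∈ K, x * y * x⁻¹ * y⁻¹ ∈ E) (hBbar : Bbar ≤ K) (hC : C ≤ K) (hB : B ≤ K)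
    (hind : ∀ bbar ∈ Bbar, ∀ c ∈ C, ∀ b ∈ B, bbar * c * b ∈ E → bbar ∈ E ∧ c ∈ E ∧ b ∈ E) :
    E.relIndex (Bbar ⊔ (C ⊔ (B ⊔ E))) = E.relIndex Bbar * E.relIndex C * E.relIndex B := by
  have hN3K : B ⊔ E ≤ K := sup_le hB hEK
  have hN2K : C ⊔ (B ⊔ E) ≤ K := sup_le hC hN3K
  -- the three steps of the tower
  have s1 : E.relIndex (B ⊔ E) = E.relIndex B :=
    relIndex_sup_right_of_le_normalizer B E (hB.trans (le_normalizer_of_le_of_le hab le_rfl hEK))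
  have s2 : (B ⊔ E).relIndex (C ⊔ (B ⊔ E)) = E.relIndex C := by
    rw [relIndex_sup_right_of_le_normalizer C (B ⊔ E) (hC.trans (le_normalizer_of_le_of_le hab le_sup_right hN3K)),
      ← Subgroup.inf_relIndex_right (B ⊔ E) C, sup_inf_eq_inf_of_independent hEK hab hB hind, Subgroup.inf_relIndex_right]
  have s3 : (C ⊔ (B ⊔ E)).relIndex (Bbar ⊔ (C ⊔ (B ⊔ E))) = E.relIndex Bbar := by
    rw [relIndex_sup_right_of_le_normalizer Bbar (C ⊔ (B ⊔ E))
        (hBbar.trans (le_normalizer_of_le_of_le hab (le_sup_right.trans le_sup_right) hN2K)),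
      ← Subgroup.inf_relIndex_right (C ⊔ (B ⊔ E)) Bbar, sup_sup_inf_eq_inf_of_independent hEK hab hC hB hind, Subgroup.inf_relIndex_right]
  -- assemble
  have t1 := Subgroup.relIndex_mul_relIndex E (B ⊔ E) (C ⊔ (B ⊔ E)) le_sup_right le_sup_right
  have t2 := Subgroup.relIndex_mul_relIndex E (C ⊔ (B ⊔ E)) (Bbar ⊔ (C ⊔ (B ⊔ E))) (le_sup_right.trans le_sup_right) le_sup_right
  rw [← t2, ← t1, s1, s2, s3]
  ring

end Algebra

/-! ## §4 (c) The Haar volume of the sandwich -/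

section Haar

variable {G : Type*} [Group G] [TopologicalSpace G] [IsTopologicalGroup G] [MeasurableSpace G] [BorelSpace G]
  {K E Bbar C B : Subgroup G}

/-- **(c) THE VOLUME OF THE SANDWICH**: `G` a topological group, `μ` a left-invariant Borel measure, `K` COMPACT, `E` OPEN (`E ≤ K`, `K ∕ E` abelian, `B̄, C, B ≤ K`,
independence): `μ(B̄ ⊔ (C ⊔ (B ⊔ E))) = [B̄ : B̄ ∩ E]·[C : C ∩ E]·[B : B ∩ E] · μ E`, the index being finite and non-zero (`P ⊇ E` is open, closed, inside the compact `K`;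
★ `measure_subgroup_eq_relIndex_mul_of_isCompact`).  On the JAC-LOC road: `ν(P̃) = D(s)·ν(K_γ)` once the three box ratios are evaluated ((L7)).
[cite: DummitFoote2004, §3.3] [cite: HarishChandra1970, Lemma 22] [cite: Rogawski1990, §12.5 p. 182] -/
theorem measure_sandwich_eq (μ : Measure G) [μ.IsMulLeftInvariant] (hEK : E ≤ K) (hab : ∀ x ∈ K, ∀ y ∈ K, x * y * x⁻¹ * y⁻¹ ∈ E)
    (hBbar : Bbar ≤ K) (hC : C ≤ K) (hB : B ≤ K)
    (hind : ∀ bbar ∈ Bbar, ∀ c ∈ C, ∀ b ∈ B, bbar * c * b ∈ E → bbar ∈ E ∧ c ∈ E ∧ b ∈ E)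
    (hKc : IsCompact (K : Set G)) (hEo : IsOpen (E : Set G)) :
    E.relIndex Bbar * E.relIndex C * E.relIndex B ≠ 0 ∧
      μ ((Bbar ⊔ (C ⊔ (B ⊔ E)) : Subgroup G) : Set G) = ((E.relIndex Bbar * E.relIndex C * E.relIndex B : ℕ) : ℝ≥0∞) * μ (E : Set G) := by
  obtain ⟨hEP, hPK⟩ := le_sandwich_and_sandwich_le (Bbar := Bbar) (C := C) (B := B) hEK hBbar hC hB
  have hPo : IsOpen (((Bbar ⊔ (C ⊔ (B ⊔ E))) : Subgroup G) : Set G) := Subgroup.isOpen_mono hEP hEo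
  have hPc : IsCompact (((Bbar ⊔ (C ⊔ (B ⊔ E))) : Subgroup G) : Set G) :=
    hKc.of_isClosed_subset (Subgroup.isClosed_of_isOpen _ hPo) (fun x hx => hPK hx)
  obtain ⟨hne, hμ⟩ := Literature.MeasureTheory.Group.measure_subgroup_eq_relIndex_mul_of_isCompact μ hEP hPc hPo hEo
  rw [relIndex_sandwich_eq hEK hab hBbar hC hB hind] at hne hμ
  exact ⟨hne, by rw [hμ]⟩

end Haar

end Summit.HodgeConjecture.HodgeConjecture.Cruxes.H413.F0P3cStCharTSAbelianSandwich
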